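import Literature.NumberTheory.GaloisCohomology.Howard2004.DVRLevelTorsionControlProofs
import Literature.NumberTheory.GaloisCohomology.Howard2004.DVRKolyvaginBoundAssemblyProofs
import Literature.NumberTheory.GaloisRepresentations.CompleteLocalFiniteLevels
import Literature.Algebra.Module.PairedTorsionModulesAlternating
import HarnessLib

/-!
# Howard 2004, Thm. 1.6.1 — the LEVELWISE STRUCTURE PACKAGE of a `DVRSetting` from LEVEL PAIRINGS
# (Thm. 1.4.2 + Prop. 1.5.5 discharged in the kernel down to Prop. 1.4.1-type data; proofs file)

Topic `NumberTheory/GaloisCohomology/Howard2004`. THEOREMS ONLY: no definition, no named fact, no instance, no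
notation, no `sorry`. Sequel of `DVRLevelTorsionControlProofs` (Lemma 1.3.3 for the levels, seat x10b-p1-w2 g14),
`DVRKolyvaginBoundAssemblyProofs` (`DVRSetting.conclusion_of_package`: the conclusion record of Thm. 1.6.1 from
the levelwise package + Lemma 1.6.4@1 + `κ_1 ≠ 0`, seat x10b-p1-w5 g6) and the pure algebra
`Literature/Algebra/Module/PairedTorsionModules{DVR,Alternating}.lean` (Thm. 1.4.2 + Prop. 1.5.5, algebraic half,
seat x10b-p1-w7 g6).

WHY (INPUTS row G87 = `Howard2004.thm161_dvrKolyvaginBound` = Howard Thm. 1.6.1; stub `stub_h161` of the μ-crux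
stmt-BirchSwinnertonDyer-22642, binder `h161` of crux 23055's print-leaf census; cell `pub/bsd-print-x9`). The
assembly theorem `DVRSetting.conclusion_of_package` consumes Howard's LEVELWISE PACKAGE — «a decomposition
`H¹_{𝓕}(K, T^{(k)}) ≅ R^{(k),ε} ⊕ M^{(k)} ⊕ M^{(k)}` in which `ε ∈ {0,1}` is independent of both `n` and `k`»
(arXiv:1202.6340 p0011 L41–46) — as the binders `(hε : ε ≤ 1) (θ : ∀ k, H¹_𝓕(K,T^{(k)}) ≃+ (Fin ε → R/𝔪^{e_k})
× (M_k × M_k)) (hθ : R-equivariance)`. In print that package is Thm. 1.4.2 + Prop. 1.5.5, whose proofs consist of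
a Galois-cohomological part (Prop. 1.4.1: Flach's generalized Cassels–Tate pairing `( , )_{s,t}` and its kernels;
the alternation of `⟨a, b⟩ = (a, π^{s-1}b)_{s,1}`, p0008 L132–p0009 L55; Lemma 1.3.3) and an algebraic part
(«`V_s/V_{s-1}` is even dimensional … the claim then follows easily from this and the structure theorem»;
«`ε + 2 dim M(n)[𝔪] = dim 𝓗(n)[𝔪]`»). This file produces the package BY NAME from the Galois-cohomological
DATA ALONE, stated on the `DVRSetting`: for each level `k` and each `s = t + 1 < e_k` an `R`-bilinear alternating
form on `H¹_𝓕(K, T^{(k)})[π^{t+1}]` (the subgroup `Sel_k ⊓ ker π^{t+1}`) with values in an `R`-module whose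
`π`-torsion is cyclic (Howard: `R^{(k)}`), whose kernel is exactly `H¹_𝓕[π^t] + π·H¹_𝓕[π^{t+2}]` («The kernel
on the right is `V_{s-1}`»). The identification of the `π`-torsions across levels that makes `ε` independent of
`k` is Lemma 1.3.3, IN THE KERNEL (`exists_mem_selmerGroup_incH1_eq_iff`, `incH1_injective`).

* §1 `mem_submoduleOfStable_selmerGroup_iff` (bookkeeping: the Selmer group as an `R`-submodule for
  `galoisCohomology.moduleH1`).
* §2 `nonempty_torsionBy_selmer_linearEquiv_succ` / `_zero`: **`H¹_𝓕(K,T^{(k)})[π] ≃ₗ[R] H¹_𝓕(K,T^{(k+1)})[π]`**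
  along `H¹(inc_k)`, hence `≃ H¹_𝓕(K,T^{(0)})[π]`.
* §3 **`exists_package_of_levelPairings`** — the package `(ε ≤ 1; n_{k,j} ∈ [1, e_k]; θ_k : H¹_𝓕(K,T^{(k)}) ≃+
  (Fin ε → R/𝔪^{e_k}) × (M_k × M_k), M_k = Π_j R/(π^{n_{k,j}}); hθ)` from the level pairings and
  `Finite H¹_𝓕(K,T^{(k)})`; **`conclusion_of_levelPairings`** — composed with `conclusion_of_package`: the
  conclusion record `S.Conclusion hy κ.one` of Thm. 1.6.1 from {level pairings, Lemma 1.6.4@1 (for any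
  decomposition), `κ_1 ≠ 0`}.

HONEST FRAMING: `thm161_dvrKolyvaginBound` is NOT proved — Prop. 1.4.1 with the alternation property, the
finiteness of the Selmer groups of the levels, and Lemma 1.6.4 remain printed inputs (hypotheses here); no summit
statement is proved; the Birch–Swinnerton-Dyer conjecture is not proved by any of this.
References: [Howard2004HeegnerKolyvagin] Thm. 1.4.2, Prop. 1.4.1, Def. 1.5.4, Prop. 1.5.5, Lemma 1.3.3, Thm. 1.6.1
(arXiv:1202.6340 pp. 7–12).
-/

set_option autoImplicit false

noncomputable section

open Function NumberField IsDedekindDomain Field Module Submodule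
open scoped NumberField ContRepresentation Pointwise

namespace Literature.NumberTheory.GaloisCohomology.Howard2004

open Literature.NumberTheory.GaloisRepresentations
open Literature.NumberTheory.GaloisRepresentations.DiscreteGaloisModule
open Literature.Algebra.Module

namespace DVRSetting

variable {p : ℕ} [Fact p.Prime] {K : Type} [Field K] [NumberField K]
  {R : Type} [CommRing R] [IsDomain R] [IsDiscreteValuationRing R] [Algebra ℤ_[p] R]
  {N : ℕ → Type} [∀ k, AddCommGroup (N k)] [∀ k, TopologicalSpace (N k)]
  [∀ k, DiscreteTopology (N k)] [∀ k, Module R (N k)]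
  {Rk : ℕ → Type} [∀ k, CommRing (Rk k)] [∀ k, IsLocalRing (Rk k)] [∀ k, TopologicalSpace (Rk k)]
  [∀ k, DiscreteTopology (Rk k)] [∀ k, Algebra ℤ_[p] (Rk k)] [∀ k, Algebra R (Rk k)]
  [∀ k, Module (Rk k) (N k)] [∀ k, IsScalarTower R (Rk k) (N k)]
  {Nbar : Type} [AddCommGroup Nbar] [TopologicalSpace Nbar] [DiscreteTopology Nbar]
  [∀ k, Module (Rk k) Nbar]
  {Nq : ℕ → Finset (HeightOneSpectrum (𝓞 K)) → Type} [∀ k n, AddCommGroup (Nq k n)]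
  [∀ k n, TopologicalSpace (Nq k n)] [∀ k n, DiscreteTopology (Nq k n)]
  [∀ k n, Module (Rk k) (Nq k n)] [∀ k n, Module R (Nq k n)]
  [∀ k n, IsScalarTower R (Rk k) (Nq k n)]

/-! ## §1 The Selmer group of a level as an `R`-submodule of `H¹(K, T^{(k)})` -/

/-- The Selmer group `H¹_F(K, T^{(k)})` as an `R`-submodule of `H¹(K, T^{(k)})` for the functorial scalar action
(`galoisCohomology.moduleH1`); membership is membership in the Selmer group.
[cite: Howard2004HeegnerKolyvagin, Def. 1.1.1 and §1.6 (arXiv:1202.6340 p0005 L3–24, p0011 L13–20)] -/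
theorem mem_submoduleOfStable_selmerGroup_iff (S : DVRSetting p K R N Rk Nbar Nq) (hy : S.SatisfiesH)
    (k : ℕ) (x : galoisCohomology (S.T.ρ k) 1) :
    x ∈ galoisCohomology.submoduleOfStable (S.T.hlin k) ((S.t k).cond).selmerGroup
        (fun r _ hx ↦ S.scalarMapH1_mem_selmerGroup hy k r hx) ↔
      x ∈ ((S.t k).cond).selmerGroup :=
  Iff.rfl

/-! ## §2 The `π`-torsion of the Selmer groups is the same at every level (Lemma 1.3.3) -/

/-- **`H¹_F(K, T^{(k)})[π] ≅ H¹_F(K, T^{(k+1)})[π]` along `H¹(inc_k)`** — the `π`-torsion case of Howard's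
Lemma 1.3.3 on a `DVRSetting` with H.0–H.5: `H¹(inc_k)` is injective (`incH1_injective`), `R`-linear
(`incH1_scalarMapH1`), carries Selmer classes to Selmer classes, and every `π`-torsion Selmer class of level
`k + 1` is in its image (`exists_mem_selmerGroup_incH1_eq_iff`, as `e_k ≥ 1`).
[cite: Howard2004HeegnerKolyvagin, Lemma 1.3.3 and Thm. 1.6.1 (proof) (arXiv:1202.6340 p0007 L152–160, p0011 L41–46)] -/
theorem nonempty_torsionBy_selmer_linearEquiv_succ (S : DVRSetting p K R N Rk Nbar Nq) (hy : S.SatisfiesH)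
    (k : ℕ) :
    letI := fun j ↦ galoisCohomology.moduleH1 (S.T.ρ j) (S.T.hlin j)
    Nonempty (↥(torsionBy R ↥(galoisCohomology.submoduleOfStable (S.T.hlin k) ((S.t k).cond).selmerGroup
        (fun r _ hx ↦ S.scalarMapH1_mem_selmerGroup hy k r hx)) S.π) ≃ₗ[R]
      ↥(torsionBy R ↥(galoisCohomology.submoduleOfStable (S.T.hlin (k + 1))
        ((S.t (k + 1)).cond).selmerGroup
        (fun r _ hx ↦ S.scalarMapH1_mem_selmerGroup hy (k + 1) r hx)) S.π)) := by
  letI modH : ∀ j, Module R (galoisCohomology (S.T.ρ j) 1) :=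
    fun j ↦ galoisCohomology.moduleH1 (S.T.ρ j) (S.T.hlin j)
  have hπm := S.π_mem_maximalIdeal hy
  have hle := S.e_le_succ hy
  have hsmul : ∀ j (r : R) (x : galoisCohomology (S.T.ρ j) 1),
      r • x = galoisCohomology.scalarMapH1 (S.T.ρ j) (S.T.hlin j) r x := fun j r x ↦ rfl
  set L₀ := galoisCohomology.submoduleOfStable (S.T.hlin k) ((S.t k).cond).selmerGroup
    (fun r _ hx ↦ S.scalarMapH1_mem_selmerGroup hy k r hx) with hL₀
  set L₁ := galoisCohomology.submoduleOfStable (S.T.hlin (k + 1)) ((S.t (k + 1)).cond).selmerGroup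
    (fun r _ hx ↦ S.scalarMapH1_mem_selmerGroup hy (k + 1) r hx) with hL₁
  let inc := S.T.incH1 S.π S.e hy.killed hy.ker_red hπm hle k
  have hinc_smul : ∀ (r : R) (c : galoisCohomology (S.T.ρ k) 1), inc (r • c) = r • inc c := fun r c ↦ by
    rw [hsmul, hsmul]
    exact AdicTower.incH1_scalarMapH1 S.T S.π S.e hy.killed hy.ker_red hπm hle k r c
  -- the map on `π`-torsion Selmer classes
  have hmem : ∀ w : ↥(torsionBy R ↥L₀ S.π), inc ((w : ↥L₀) : galoisCohomology (S.T.ρ k) 1) ∈ L₁ :=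
    fun w ↦ S.incH1_mem_selmerGroup hy hπm hle k (w : ↥L₀).2
  have htor : ∀ w : ↥(torsionBy R ↥L₀ S.π),
      (⟨inc ((w : ↥L₀) : galoisCohomology (S.T.ρ k) 1), hmem w⟩ : ↥L₁) ∈ torsionBy R ↥L₁ S.π := fun w ↦ by
    have hw : S.π • ((w : ↥L₀) : galoisCohomology (S.T.ρ k) 1) = 0 := by
      have h := (mem_torsionBy_iff _ _).1 w.2
      rw [Subtype.ext_iff, Submodule.coe_smul] at h
      exact h
    rw [mem_torsionBy_iff, Subtype.ext_iff, Submodule.coe_smul, Submodule.coe_zero]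
    change S.π • inc _ = 0
    rw [← hinc_smul, hw, map_zero]
  let s : ↥(torsionBy R ↥L₀ S.π) →ₗ[R] ↥(torsionBy R ↥L₁ S.π) :=
    { toFun := fun w ↦ ⟨⟨inc ((w : ↥L₀) : galoisCohomology (S.T.ρ k) 1), hmem w⟩, htor w⟩
      map_add' := fun w w' ↦ Subtype.ext (Subtype.ext (by
        simp only [Submodule.coe_add, map_add]))
      map_smul' := fun r w ↦ Subtype.ext (Subtype.ext (by
        simp only [Submodule.coe_smul, RingHom.id_apply]
        exact hinc_smul r _)) }
  refine ⟨LinearEquiv.ofBijective s ⟨fun w w' h ↦ ?_, fun u ↦ ?_⟩⟩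
  · have h1 : inc ((w : ↥L₀) : galoisCohomology (S.T.ρ k) 1) = inc ((w' : ↥L₀) : _) :=
      congrArg (fun z : ↥(torsionBy R ↥L₁ S.π) ↦ ((z : ↥L₁) : galoisCohomology (S.T.ρ (k + 1)) 1)) h
    exact Subtype.ext (Subtype.ext (S.incH1_injective hy hπm hle k h1))
  · -- a `π`-torsion Selmer class of level `k+1` is killed by `π^{e_k}`, hence comes from level `k`
    have hu : S.π • ((u : ↥L₁) : galoisCohomology (S.T.ρ (k + 1)) 1) = 0 := by
      have h := (mem_torsionBy_iff _ _).1 u.2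
      rw [Subtype.ext_iff, Submodule.coe_smul] at h
      exact h
    have he : 1 ≤ S.e k := le_trans hy.e_zero (hy.e_strictMono.monotone (Nat.zero_le k))
    have hu' : galoisCohomology.scalarMapH1 (S.T.ρ (k + 1)) (S.T.hlin (k + 1)) (S.π ^ S.e k)
        ((u : ↥L₁) : galoisCohomology (S.T.ρ (k + 1)) 1) = 0 := by
      obtain ⟨d, hd⟩ : ∃ d, S.e k = d + 1 := ⟨S.e k - 1, by omega⟩
      rw [← hsmul, hd, pow_succ, mul_smul, hu, smul_zero]
    obtain ⟨c', hc', hcc'⟩ := (S.exists_mem_selmerGroup_incH1_eq_iff hy hπm hle k _).2 ⟨(u : ↥L₁).2, hu'⟩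
    have hc'tor : (⟨c', hc'⟩ : ↥L₀) ∈ torsionBy R ↥L₀ S.π := by
      rw [mem_torsionBy_iff, Subtype.ext_iff, Submodule.coe_smul, Submodule.coe_zero]
      apply S.incH1_injective hy hπm hle k
      change inc (S.π • c') = inc 0
      rw [hinc_smul, map_zero]
      rw [show inc c' = ((u : ↥L₁) : galoisCohomology (S.T.ρ (k + 1)) 1) from hcc', hu]
    exact ⟨⟨⟨c', hc'⟩, hc'tor⟩, Subtype.ext (Subtype.ext hcc')⟩

/-- `H¹_F(K, T^{(k)})[π] ≅ H¹_F(K, T^{(0)})[π]` for every level `k` (iterate the one-step identification).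
[cite: Howard2004HeegnerKolyvagin, Lemma 1.3.3 and Thm. 1.6.1 (proof) (arXiv:1202.6340 p0007 L152–160, p0011 L41–46)] -/
theorem nonempty_torsionBy_selmer_linearEquiv_zero (S : DVRSetting p K R N Rk Nbar Nq) (hy : S.SatisfiesH)
    (k : ℕ) :
    letI := fun j ↦ galoisCohomology.moduleH1 (S.T.ρ j) (S.T.hlin j)
    Nonempty (↥(torsionBy R ↥(galoisCohomology.submoduleOfStable (S.T.hlin k) ((S.t k).cond).selmerGroup
        (fun r _ hx ↦ S.scalarMapH1_mem_selmerGroup hy k r hx)) S.π) ≃ₗ[R]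
      ↥(torsionBy R ↥(galoisCohomology.submoduleOfStable (S.T.hlin 0)
        ((S.t 0).cond).selmerGroup
        (fun r _ hx ↦ S.scalarMapH1_mem_selmerGroup hy 0 r hx)) S.π)) := by
  letI modH : ∀ j, Module R (galoisCohomology (S.T.ρ j) 1) :=
    fun j ↦ galoisCohomology.moduleH1 (S.T.ρ j) (S.T.hlin j)
  induction k with
  | zero => exact ⟨LinearEquiv.refl R _⟩
  | succ k ih =>
    obtain ⟨f⟩ := ih
    obtain ⟨s⟩ := S.nonempty_torsionBy_selmer_linearEquiv_succ hy k
    exact ⟨s.symm.trans f⟩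

/-! ## §3 The levelwise structure package from level pairings -/

/-- **One level: `H¹_𝓕(K, T^{(k)}) ≅ (R/𝔪^{e_k})^{ε_k} × (M_k × M_k)`, `ε_k ≤ 1`, from the level-`k` pairings**
(Howard's Thm. 1.4.2 for `T^{(k)}` over `R^{(k)} = R/𝔪^{e_k}`: the Galois side supplies, for each `s = t+1 < e_k`,
an alternating `R`-bilinear form on `H¹_𝓕(K,T^{(k)})[π^{t+1}] = Sel_k ⊓ ker π^{t+1}` with values in a module with
cyclic `π`-torsion and kernel exactly `H¹_𝓕[π^t] + π·H¹_𝓕[π^{t+2}]`; the algebra is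
`Literature.Algebra.Module.exists_linearEquiv_pi_maximalIdeal_pow_prod_pi_prod_self_of_isAlt`). The isomorphism
is `R`-LINEAR for the functorial module structure `galoisCohomology.moduleH1` on the Selmer submodule.
[cite: Howard2004HeegnerKolyvagin, Thm. 1.4.2 and Thm. 1.6.1 (proof) (arXiv:1202.6340 p0008 L100–L139, p0011 L39–L46)] -/
theorem exists_levelPackage_of_levelPairings (S : DVRSetting p K R N Rk Nbar Nq) (hy : S.SatisfiesH) (k : ℕ)
    (hfin : Finite ↥((S.t k).cond).selmerGroup)
    {P : ℕ → Type} [∀ t, AddCommGroup (P t)] [∀ t, Module R (P t)]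
    (hP : ∀ t (a b : P t), S.π • a = 0 → S.π • b = 0 → a ≠ 0 → ∃ r : R, b = r • a)
    (B : ∀ t, ↥(((S.t k).cond).selmerGroup ⊓
        (galoisCohomology.scalarMapH1 (S.T.ρ k) (S.T.hlin k) (S.π ^ (t + 1))).ker) →+
      ↥(((S.t k).cond).selmerGroup ⊓
        (galoisCohomology.scalarMapH1 (S.T.ρ k) (S.T.hlin k) (S.π ^ (t + 1))).ker) →+ P t)
    (hB₁ : ∀ t (r : R) (x x' y : ↥(((S.t k).cond).selmerGroup ⊓
        (galoisCohomology.scalarMapH1 (S.T.ρ k) (S.T.hlin k) (S.π ^ (t + 1))).ker)),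
      (x' : galoisCohomology (S.T.ρ k) 1) =
        galoisCohomology.scalarMapH1 (S.T.ρ k) (S.T.hlin k) r (x : galoisCohomology (S.T.ρ k) 1) →
      B t x' y = r • B t x y)
    (hB₂ : ∀ t (r : R) (x y y' : ↥(((S.t k).cond).selmerGroup ⊓
        (galoisCohomology.scalarMapH1 (S.T.ρ k) (S.T.hlin k) (S.π ^ (t + 1))).ker)),
      (y' : galoisCohomology (S.T.ρ k) 1) =
        galoisCohomology.scalarMapH1 (S.T.ρ k) (S.T.hlin k) r (y : galoisCohomology (S.T.ρ k) 1) →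
      B t x y' = r • B t x y)
    (halt : ∀ t, t + 1 < S.e k → ∀ x, B t x x = 0)
    (hker : ∀ t, t + 1 < S.e k → ∀ x : ↥(((S.t k).cond).selmerGroup ⊓
        (galoisCohomology.scalarMapH1 (S.T.ρ k) (S.T.hlin k) (S.π ^ (t + 1))).ker),
      (∀ y, B t x y = 0) ↔
        ∃ y ∈ ((S.t k).cond).selmerGroup, ∃ z ∈ ((S.t k).cond).selmerGroup,
          galoisCohomology.scalarMapH1 (S.T.ρ k) (S.T.hlin k) (S.π ^ t) y = 0 ∧
          galoisCohomology.scalarMapH1 (S.T.ρ k) (S.T.hlin k) (S.π ^ (t + 2)) z = 0 ∧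
          (x : galoisCohomology (S.T.ρ k) 1) =
            y + galoisCohomology.scalarMapH1 (S.T.ρ k) (S.T.hlin k) S.π z) :
    letI := fun j ↦ galoisCohomology.moduleH1 (S.T.ρ j) (S.T.hlin j)
    ∃ (ε m : ℕ) (n : Fin m → ℕ), ε ≤ 1 ∧ (∀ j, 1 ≤ n j ∧ n j ≤ S.e k) ∧
      Nonempty (↥(galoisCohomology.submoduleOfStable (S.T.hlin k) ((S.t k).cond).selmerGroup
          (fun r _ hx ↦ S.scalarMapH1_mem_selmerGroup hy k r hx)) ≃ₗ[R]
        ((Fin ε → R ⧸ IsLocalRing.maximalIdeal R ^ S.e k) ×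
          ((Π j, R ⧸ Ideal.span {S.π ^ n j}) × (Π j, R ⧸ Ideal.span {S.π ^ n j})))) := by
  classical
  letI modH : ∀ j, Module R (galoisCohomology (S.T.ρ j) 1) :=
    fun j ↦ galoisCohomology.moduleH1 (S.T.ρ j) (S.T.hlin j)
  have hπm := S.π_mem_maximalIdeal hy
  have hirr : Irreducible S.π := (IsDiscreteValuationRing.irreducible_iff_uniformizer S.π).mpr hy.unif
  have hsmul : ∀ (r : R) (x : galoisCohomology (S.T.ρ k) 1),
      r • x = galoisCohomology.scalarMapH1 (S.T.ρ k) (S.T.hlin k) r x := fun r x ↦ rfl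
  -- the Selmer submodule `L`
  set L : Submodule R (galoisCohomology (S.T.ρ k) 1) :=
    galoisCohomology.submoduleOfStable (S.T.hlin k) ((S.t k).cond).selmerGroup
      (fun r _ hx ↦ S.scalarMapH1_mem_selmerGroup hy k r hx) with hLdef
  have hL : ∀ x : galoisCohomology (S.T.ρ k) 1, x ∈ L ↔ x ∈ ((S.t k).cond).selmerGroup := fun x ↦ Iff.rfl
  haveI : Module.Finite R ↥L := by
    haveI : Finite ↥L := Finite.of_equiv _ (Equiv.subtypeEquivRight (fun x ↦ (hL x).symm))
    exact Module.Finite.of_finite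
  have hkill : ∀ x : ↥L, S.π ^ S.e k • x = 0 := fun x ↦ Subtype.ext (by
    rw [Submodule.coe_smul, Submodule.coe_zero]
    exact galoisCohomology.smul_eq_zero_of_forall (S.T.ρ k) (S.T.hlin k) _
      (fun m ↦ hy.killed k _ (Ideal.pow_mem_pow hπm _) m) _)
  -- `L[π^{t+1}]` is the subgroup `Sel_k ⊓ ker(π^{t+1})` on which the pairings live
  have hWV : ∀ t (w : ↥(torsionBy R ↥L (S.π ^ (t + 1)))),
      ((w : ↥L) : galoisCohomology (S.T.ρ k) 1) ∈ ((S.t k).cond).selmerGroup ⊓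
        (galoisCohomology.scalarMapH1 (S.T.ρ k) (S.T.hlin k) (S.π ^ (t + 1))).ker := fun t w ↦ by
    refine AddSubgroup.mem_inf.2 ⟨(w : ↥L).2, ?_⟩
    have h := (mem_torsionBy_iff _ _).1 w.2
    rw [Subtype.ext_iff, Submodule.coe_smul, Submodule.coe_zero, hsmul] at h
    exact h
  let toV : ∀ t, ↥(torsionBy R ↥L (S.π ^ (t + 1))) →
      ↥(((S.t k).cond).selmerGroup ⊓
        (galoisCohomology.scalarMapH1 (S.T.ρ k) (S.T.hlin k) (S.π ^ (t + 1))).ker) :=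
    fun t w ↦ ⟨((w : ↥L) : galoisCohomology (S.T.ρ k) 1), hWV t w⟩
  have htoV : ∀ t (w : ↥(torsionBy R ↥L (S.π ^ (t + 1)))),
      (toV t w : galoisCohomology (S.T.ρ k) 1) = ((w : ↥L) : galoisCohomology (S.T.ρ k) 1) :=
    fun t w ↦ rfl
  have htoV_add : ∀ t (w w' : ↥(torsionBy R ↥L (S.π ^ (t + 1)))),
      toV t (w + w') = toV t w + toV t w' := fun t w w' ↦ Subtype.ext rfl
  have htoV_smul : ∀ t (r : R) (w : ↥(torsionBy R ↥L (S.π ^ (t + 1)))),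
      (toV t (r • w) : galoisCohomology (S.T.ρ k) 1) =
        galoisCohomology.scalarMapH1 (S.T.ρ k) (S.T.hlin k) r (toV t w : galoisCohomology (S.T.ρ k) 1) :=
    fun t r w ↦ rfl
  have htoV_surj : ∀ t (v : ↥(((S.t k).cond).selmerGroup ⊓
      (galoisCohomology.scalarMapH1 (S.T.ρ k) (S.T.hlin k) (S.π ^ (t + 1))).ker)),
      ∃ w, toV t w = v := fun t v ↦ by
    obtain ⟨hv₁, hv₂⟩ := AddSubgroup.mem_inf.1 v.2
    refine ⟨⟨⟨(v : galoisCohomology (S.T.ρ k) 1), hv₁⟩, ?_⟩, Subtype.ext rfl⟩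
    rw [mem_torsionBy_iff, Subtype.ext_iff, Submodule.coe_smul, Submodule.coe_zero, hsmul]
    exact (AddMonoidHom.mem_ker).1 hv₂
  -- the pairings as `R`-bilinear maps on `L[π^{t+1}]`
  let B' : ∀ t, ↥(torsionBy R ↥L (S.π ^ (t + 1))) →ₗ[R] ↥(torsionBy R ↥L (S.π ^ (t + 1))) →ₗ[R] P t :=
    fun t ↦ LinearMap.mk₂ R (fun a b ↦ B t (toV t a) (toV t b))
      (fun a₁ a₂ b ↦ by rw [htoV_add, map_add, AddMonoidHom.add_apply])
      (fun r a b ↦ hB₁ t r (toV t a) (toV t (r • a)) (toV t b) (htoV_smul t r a))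
      (fun a b₁ b₂ ↦ by rw [htoV_add, map_add])
      (fun r a b ↦ hB₂ t r (toV t a) (toV t b) (toV t (r • b)) (htoV_smul t r b))
  have hB'apply : ∀ t a b, B' t a b = B t (toV t a) (toV t b) := fun t a b ↦ rfl
  have halt' : ∀ t, t + 1 < S.e k → ∀ a, B' t a a = 0 := fun t ht a ↦ by
    rw [hB'apply]
    exact halt t ht _
  have hker' : ∀ t, t + 1 < S.e k → ∀ a : ↥(torsionBy R ↥L (S.π ^ (t + 1))),
      (∀ b, B' t a b = 0) ↔ (a : ↥L) ∈ torsionBy R ↥L (S.π ^ t) ⊔ S.π • torsionBy R ↥L (S.π ^ (t + 2)) := by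
    intro t ht a
    have step1 : (∀ b, B' t a b = 0) ↔ ∀ v, B t (toV t a) v = 0 := by
      constructor
      · intro h v
        obtain ⟨w, rfl⟩ := htoV_surj t v
        rw [← hB'apply]
        exact h w
      · intro h b
        rw [hB'apply]
        exact h _
    rw [step1, hker t ht, mem_sup]
    constructor
    · rintro ⟨y, hy₁, z, hz₁, hy0, hz0, hyz⟩
      refine ⟨⟨y, hy₁⟩, ?_, S.π • ⟨z, hz₁⟩, smul_mem_pointwise_smul _ _ _ ?_, ?_⟩
      · rw [mem_torsionBy_iff, Subtype.ext_iff, Submodule.coe_smul, Submodule.coe_zero, hsmul]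
        exact hy0
      · rw [mem_torsionBy_iff, Subtype.ext_iff, Submodule.coe_smul, Submodule.coe_zero, hsmul]
        exact hz0
      · apply Subtype.ext
        rw [Submodule.coe_add, Submodule.coe_smul, hsmul, ← hyz]
    · rintro ⟨u, hu, w, hw, huw⟩
      obtain ⟨c, hc, rfl⟩ := (mem_smul_pointwise_iff_exists _ _ _).1 hw
      refine ⟨(u : galoisCohomology (S.T.ρ k) 1), u.2, (c : galoisCohomology (S.T.ρ k) 1), c.2, ?_, ?_, ?_⟩
      · have h := (mem_torsionBy_iff _ _).1 hu
        rw [Subtype.ext_iff, Submodule.coe_smul, Submodule.coe_zero, hsmul] at h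
        exact h
      · have h := (mem_torsionBy_iff _ _).1 hc
        rw [Subtype.ext_iff, Submodule.coe_smul, Submodule.coe_zero, hsmul] at h
        exact h
      · rw [htoV, ← huw, Submodule.coe_add, Submodule.coe_smul, hsmul]
  -- the algebra
  exact Literature.Algebra.Module.exists_linearEquiv_pi_maximalIdeal_pow_prod_pi_prod_self_of_isAlt hirr hkill
    hP B' halt' hker'

/-- **HOWARD 2004, THM. 1.6.1 — THE LEVELWISE PACKAGE `H¹_𝓕(K, T^{(k)}) ≅ R^{(k),ε} ⊕ M^{(k)} ⊕ M^{(k)}`, ONE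
`ε ∈ {0,1}`, FROM LEVEL PAIRINGS.** On a `DVRSetting` with H.0–H.5 whose Selmer groups `H¹_𝓕(K, T^{(k)})` are
finite, suppose that for every level `k` and every `s = t + 1 < e_k` there is an `R`-bilinear ALTERNATING form
`B_{k,t}` on `H¹_𝓕(K, T^{(k)})[π^{t+1}]` with values in an `R`-module whose `π`-torsion is cyclic (for Howard:
`R^{(k)} = R/𝔪^{e_k}`, `⟨a, b⟩ = (a, π^{t} b)_{t+1,1}` of Prop. 1.4.1 under the identifications of Lemma 1.3.3,
alternating by p0008 L140–p0009 L55) whose kernel is EXACTLY `H¹_𝓕[π^t] + π·H¹_𝓕[π^{t+2}]` ("The kernel on the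
right is `V_{s-1}`"). Then there are ONE `ε ≤ 1`, explicit exponents `1 ≤ n_{k,j} ≤ e_k` and, for every `k`, an
additive `R`-equivariant `θ_k : H¹_𝓕(K, T^{(k)}) ≃ (R/𝔪^{e_k})^ε × (M_k × M_k)`, `M_k = Π_j R/(π^{n_{k,j}})` —
EXACTLY the binders `(hε, θ, hθ)` of `DVRSetting.conclusion_of_package` (with `Finite (M_k)` from the finite
residue field, `finite_quotient_span_pi_pow`). "`ε` is independent of `k`" (Prop. 1.5.5) uses the `π`-torsion
identifications of Lemma 1.3.3, in the kernel (`nonempty_torsionBy_selmer_linearEquiv_zero`), and the algebra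
`Literature.Algebra.Module.exists_uniform_epsilon_of_torsionBy_linearEquiv`.
[cite: Howard2004HeegnerKolyvagin, Thm. 1.4.2, Prop. 1.5.5 and Thm. 1.6.1 (proof) (arXiv:1202.6340 p0008 L100–L139, p0010 L50–L75, p0011 L39–L46)] -/
theorem exists_package_of_levelPairings (S : DVRSetting p K R N Rk Nbar Nq) (hy : S.SatisfiesH)
    (hfin : ∀ k, Finite ↥((S.t k).cond).selmerGroup)
    {P : ℕ → ℕ → Type} [∀ k t, AddCommGroup (P k t)] [∀ k t, Module R (P k t)]
    (hP : ∀ k t (a b : P k t), S.π • a = 0 → S.π • b = 0 → a ≠ 0 → ∃ r : R, b = r • a)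
    (B : ∀ k t, ↥(((S.t k).cond).selmerGroup ⊓
        (galoisCohomology.scalarMapH1 (S.T.ρ k) (S.T.hlin k) (S.π ^ (t + 1))).ker) →+
      ↥(((S.t k).cond).selmerGroup ⊓
        (galoisCohomology.scalarMapH1 (S.T.ρ k) (S.T.hlin k) (S.π ^ (t + 1))).ker) →+ P k t)
    (hB₁ : ∀ k t (r : R) (x x' y : ↥(((S.t k).cond).selmerGroup ⊓
        (galoisCohomology.scalarMapH1 (S.T.ρ k) (S.T.hlin k) (S.π ^ (t + 1))).ker)),
      (x' : galoisCohomology (S.T.ρ k) 1) =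
        galoisCohomology.scalarMapH1 (S.T.ρ k) (S.T.hlin k) r (x : galoisCohomology (S.T.ρ k) 1) →
      B k t x' y = r • B k t x y)
    (hB₂ : ∀ k t (r : R) (x y y' : ↥(((S.t k).cond).selmerGroup ⊓
        (galoisCohomology.scalarMapH1 (S.T.ρ k) (S.T.hlin k) (S.π ^ (t + 1))).ker)),
      (y' : galoisCohomology (S.T.ρ k) 1) =
        galoisCohomology.scalarMapH1 (S.T.ρ k) (S.T.hlin k) r (y : galoisCohomology (S.T.ρ k) 1) →
      B k t x y' = r • B k t x y)
    (halt : ∀ k t, t + 1 < S.e k → ∀ x, B k t x x = 0)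
    (hker : ∀ k t, t + 1 < S.e k → ∀ x : ↥(((S.t k).cond).selmerGroup ⊓
        (galoisCohomology.scalarMapH1 (S.T.ρ k) (S.T.hlin k) (S.π ^ (t + 1))).ker),
      (∀ y, B k t x y = 0) ↔
        ∃ y ∈ ((S.t k).cond).selmerGroup, ∃ z ∈ ((S.t k).cond).selmerGroup,
          galoisCohomology.scalarMapH1 (S.T.ρ k) (S.T.hlin k) (S.π ^ t) y = 0 ∧
          galoisCohomology.scalarMapH1 (S.T.ρ k) (S.T.hlin k) (S.π ^ (t + 2)) z = 0 ∧
          (x : galoisCohomology (S.T.ρ k) 1) =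
            y + galoisCohomology.scalarMapH1 (S.T.ρ k) (S.T.hlin k) S.π z) :
    ∃ (ε : ℕ) (m : ℕ → ℕ) (n : ∀ k, Fin (m k) → ℕ), ε ≤ 1 ∧ (∀ k j, 1 ≤ n k j ∧ n k j ≤ S.e k) ∧
      ∀ k, ∃ θ : ↥((S.t k).cond).selmerGroup ≃+
          ((Fin ε → R ⧸ IsLocalRing.maximalIdeal R ^ S.e k) ×
            ((Π j, R ⧸ Ideal.span {S.π ^ n k j}) × (Π j, R ⧸ Ideal.span {S.π ^ n k j}))),
        ∀ (r : R) (y : galoisCohomology (S.T.ρ k) 1) (hy' : y ∈ ((S.t k).cond).selmerGroup),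
          θ ⟨galoisCohomology.scalarMapH1 (S.T.ρ k) (S.T.hlin k) r y,
              S.scalarMapH1_mem_selmerGroup hy k r hy'⟩ = r • θ ⟨y, hy'⟩ := by
  classical
  letI modH : ∀ j, Module R (galoisCohomology (S.T.ρ j) 1) :=
    fun j ↦ galoisCohomology.moduleH1 (S.T.ρ j) (S.T.hlin j)
  have hirr : Irreducible S.π := (IsDiscreteValuationRing.irreducible_iff_uniformizer S.π).mpr hy.unif
  have hsmul : ∀ j (r : R) (x : galoisCohomology (S.T.ρ j) 1),
      r • x = galoisCohomology.scalarMapH1 (S.T.ρ j) (S.T.hlin j) r x := fun j r x ↦ rfl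
  let L : ∀ k, Submodule R (galoisCohomology (S.T.ρ k) 1) := fun k ↦
    galoisCohomology.submoduleOfStable (S.T.hlin k) ((S.t k).cond).selmerGroup
      (fun r _ hx ↦ S.scalarMapH1_mem_selmerGroup hy k r hx)
  have hL : ∀ k (x : galoisCohomology (S.T.ρ k) 1), x ∈ L k ↔ x ∈ ((S.t k).cond).selmerGroup :=
    fun k x ↦ Iff.rfl
  have he : ∀ k, 1 ≤ S.e k := fun k ↦ le_trans hy.e_zero (hy.e_strictMono.monotone (Nat.zero_le k))
  -- per-level packages
  have hlev := fun k ↦ S.exists_levelPackage_of_levelPairings hy k (hfin k) (hP k) (B k) (hB₁ k) (hB₂ k)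
    (halt k) (hker k)
  choose ε m n hε hn hNE using hlev
  have θ : ∀ k, ↥(L k) ≃ₗ[R] ((Fin (ε k) → R ⧸ IsLocalRing.maximalIdeal R ^ S.e k) ×
      ((Π j, R ⧸ Ideal.span {S.π ^ n k j}) × (Π j, R ⧸ Ideal.span {S.π ^ n k j}))) :=
    fun k ↦ (hNE k).some
  -- the `π`-torsion identifications (Lemma 1.3.3) make `ε` uniform (Prop. 1.5.5)
  have f : ∀ k, ↥(torsionBy R ↥(L k) S.π) ≃ₗ[R] ↥(torsionBy R ↥(L 0) S.π) :=
    fun k ↦ (S.nonempty_torsionBy_selmer_linearEquiv_zero hy k).some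
  obtain ⟨ε₀, hε₀, h⟩ := Literature.Algebra.Module.exists_uniform_epsilon_of_torsionBy_linearEquiv hirr hε
    (C := fun k ↦ R ⧸ IsLocalRing.maximalIdeal R ^ S.e k)
    (fun k ↦ Literature.Algebra.Module.finrank_torsionBy_quotient_maximalIdeal_pow hirr (he k))
    (M := fun k ↦ Π j, R ⧸ Ideal.span {S.π ^ n k j}) θ f
  refine ⟨ε₀, m, n, hε₀, hn, fun k ↦ ?_⟩
  obtain ⟨e⟩ := h k
  let ι : ↥((S.t k).cond).selmerGroup ≃+ ↥(L k) :=
    { toFun := fun y ↦ ⟨(y : galoisCohomology (S.T.ρ k) 1), (hL k _).2 y.2⟩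
      invFun := fun x ↦ ⟨(x : galoisCohomology (S.T.ρ k) 1), (hL k _).1 x.2⟩
      left_inv := fun _ ↦ rfl
      right_inv := fun _ ↦ rfl
      map_add' := fun _ _ ↦ rfl }
  refine ⟨ι.trans e.toAddEquiv, fun r y hy' ↦ ?_⟩
  have h1 : ι ⟨galoisCohomology.scalarMapH1 (S.T.ρ k) (S.T.hlin k) r y,
      S.scalarMapH1_mem_selmerGroup hy k r hy'⟩ = r • ι ⟨y, hy'⟩ :=
    Subtype.ext (by rw [Submodule.coe_smul, hsmul]; rfl)
  rw [AddEquiv.trans_apply, AddEquiv.trans_apply, h1, LinearEquiv.coe_toAddEquiv]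
  exact map_smul e r _

/-- `R/(π^a)` is finite on a `DVRSetting` with H.0–H.5 (finite residue field, `(π^a) = 𝔪^a`).
[cite: Howard2004HeegnerKolyvagin, §1 conventions (coefficient rings; arXiv:1202.6340 p0004 L47–52)] -/
theorem finite_quotient_span_pi_pow (S : DVRSetting p K R N Rk Nbar Nq) (hy : S.SatisfiesH) (a : ℕ) :
    Finite (R ⧸ Ideal.span {S.π ^ a}) := by
  haveI : Finite (IsLocalRing.ResidueField R) := hy.coeffRing.finite_residueField
  haveI : Finite (R ⧸ IsLocalRing.maximalIdeal R ^ a) := CompleteLocalRing.finite_quotient_maximalIdeal_pow a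
  have h : IsLocalRing.maximalIdeal R ^ a = Ideal.span {S.π ^ a} := by rw [hy.unif, Ideal.span_singleton_pow]
  exact Finite.of_equiv _ (Ideal.quotEquivOfEq h).toEquiv

/-- **HOWARD 2004, THM. 1.6.1 FROM LEVEL PAIRINGS + LEMMA 1.6.4@1 + `κ_1 ≠ 0`.** The conclusion record
`S.Conclusion hy κ.one` ((i) `H¹_𝓕(K, T)` free of rank one; (ii) `H¹_𝓕(K, A) ≅ 𝒟 ⊕ M ⊕ M`; (iii)
`len M ≤ len(H¹_𝓕(K, T)/R·κ_1)`) on a `DVRSetting` with H.0–H.5, from: the finiteness of the level Selmer groups,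
the level pairings of `exists_package_of_levelPairings` (Prop. 1.4.1-type data), Lemma 1.6.4 at `n = 1` for ANY
admissible decomposition («`κ_1^{(k)} ∈ Stub^{(k)} = 𝔪^{len M^{(k)}} H¹_𝓕(K, T^{(k)})`», p0012 L30–32, with
Def. 1.5.4), and `κ_1 ≠ 0` — `conclusion_of_package` ∘ `exists_package_of_levelPairings`.
[cite: Howard2004HeegnerKolyvagin, Thm. 1.6.1 and its proof (arXiv:1202.6340 Thm. 2.6.1, p0011 L23–28, p0012 L29–55)] -/
theorem conclusion_of_levelPairings (S : DVRSetting p K R N Rk Nbar Nq) (κ : S.KolyvaginSystem)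
    (hy : S.SatisfiesH) (hfin : ∀ k, Finite ↥((S.t k).cond).selmerGroup)
    {P : ℕ → ℕ → Type} [∀ k t, AddCommGroup (P k t)] [∀ k t, Module R (P k t)]
    (hP : ∀ k t (a b : P k t), S.π • a = 0 → S.π • b = 0 → a ≠ 0 → ∃ r : R, b = r • a)
    (B : ∀ k t, ↥(((S.t k).cond).selmerGroup ⊓
        (galoisCohomology.scalarMapH1 (S.T.ρ k) (S.T.hlin k) (S.π ^ (t + 1))).ker) →+
      ↥(((S.t k).cond).selmerGroup ⊓
        (galoisCohomology.scalarMapH1 (S.T.ρ k) (S.T.hlin k) (S.π ^ (t + 1))).ker) →+ P k t)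
    (hB₁ : ∀ k t (r : R) (x x' y : ↥(((S.t k).cond).selmerGroup ⊓
        (galoisCohomology.scalarMapH1 (S.T.ρ k) (S.T.hlin k) (S.π ^ (t + 1))).ker)),
      (x' : galoisCohomology (S.T.ρ k) 1) =
        galoisCohomology.scalarMapH1 (S.T.ρ k) (S.T.hlin k) r (x : galoisCohomology (S.T.ρ k) 1) →
      B k t x' y = r • B k t x y)
    (hB₂ : ∀ k t (r : R) (x y y' : ↥(((S.t k).cond).selmerGroup ⊓
        (galoisCohomology.scalarMapH1 (S.T.ρ k) (S.T.hlin k) (S.π ^ (t + 1))).ker)),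
      (y' : galoisCohomology (S.T.ρ k) 1) =
        galoisCohomology.scalarMapH1 (S.T.ρ k) (S.T.hlin k) r (y : galoisCohomology (S.T.ρ k) 1) →
      B k t x y' = r • B k t x y)
    (halt : ∀ k t, t + 1 < S.e k → ∀ x, B k t x x = 0)
    (hker : ∀ k t, t + 1 < S.e k → ∀ x : ↥(((S.t k).cond).selmerGroup ⊓
        (galoisCohomology.scalarMapH1 (S.T.ρ k) (S.T.hlin k) (S.π ^ (t + 1))).ker),
      (∀ y, B k t x y = 0) ↔
        ∃ y ∈ ((S.t k).cond).selmerGroup, ∃ z ∈ ((S.t k).cond).selmerGroup,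
          galoisCohomology.scalarMapH1 (S.T.ρ k) (S.T.hlin k) (S.π ^ t) y = 0 ∧
          galoisCohomology.scalarMapH1 (S.T.ρ k) (S.T.hlin k) (S.π ^ (t + 2)) z = 0 ∧
          (x : galoisCohomology (S.T.ρ k) 1) =
            y + galoisCohomology.scalarMapH1 (S.T.ρ k) (S.T.hlin k) S.π z)
    (h164 : ∀ k (ε : ℕ), ε ≤ 1 → ∀ (M : Type) [AddCommGroup M] [Module R M] [Finite M]
      (θ : ↥((S.t k).cond).selmerGroup ≃+ ((Fin ε → R ⧸ IsLocalRing.maximalIdeal R ^ S.e k) × (M × M))),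
      (∀ (r : R) (y : galoisCohomology (S.T.ρ k) 1) (hy' : y ∈ ((S.t k).cond).selmerGroup),
        θ ⟨galoisCohomology.scalarMapH1 (S.T.ρ k) (S.T.hlin k) r y,
          S.scalarMapH1_mem_selmerGroup hy k r hy'⟩ = r • θ ⟨y, hy'⟩) →
      ∃ y ∈ ((S.t k).cond).selmerGroup,
        κ.one k = galoisCohomology.scalarMapH1 (S.T.ρ k) (S.T.hlin k)
          (S.π ^ (Module.length R M).toNat) y)
    (hone : κ.one ≠ 0) : S.Conclusion hy κ.one := by
  obtain ⟨ε, m, n, hε, -, hθ⟩ := S.exists_package_of_levelPairings hy hfin hP B hB₁ hB₂ halt hker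
  choose θ hθ using hθ
  haveI : ∀ k, Finite (Π j : Fin (m k), R ⧸ Ideal.span {S.π ^ n k j}) := fun k ↦ by
    haveI : ∀ j : Fin (m k), Finite (R ⧸ Ideal.span {S.π ^ n k j}) :=
      fun j ↦ S.finite_quotient_span_pi_pow hy (n k j)
    infer_instance
  exact S.conclusion_of_package κ hy hε (M := fun k ↦ Π j : Fin (m k), R ⧸ Ideal.span {S.π ^ n k j}) θ hθ
    (fun k ↦ h164 k ε hε _ (θ k) (hθ k)) hone

end DVRSetting

end Literature.NumberTheory.GaloisCohomology.Howard2004
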